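import Literature.RingTheory.Koszul.RegularSequenceFirstHomology
import Mathlib.LinearAlgebra.Quotient.Basic
import Mathlib.LinearAlgebra.Finsupp.LinearCombination
import HarnessLib

/-!
# [OURS · L1 W4.5(b) · EL♮(3) · (T-k) · J1c brick (ν2)] Homomorphisms out of an ideal generated by a regular sequence into a module it kills are
# FREE on the generators: `Hom_R((x₁,…,x_n), Q) ≃ Qⁿ` (values on the generators; first syzygies are Koszul)

Crux chain w45b (cell `res-hironaka`), crux **EL♮(3)** = stmt-ResolutionOfSingularities-20148; NEED-FACT J1 = `EmbeddedInfinitesimalLiftFact` (p596985);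
J1c design `Cruxes/EquisingularLiftNatThree/Lines/J1c-DESIGN-res-type-027.md`, brick (ν2): the CLASSES side of «difference classes = sections of the
normal sheaf» — on an affine piece where the lift `I' = (a'₁,…,a'_n)` is generated by the lifted regular sequence (brick (λ), p601260), a class
`φ : I' →ₗ[A'] A'/(I' + 𝔪A')` (J1b, p599860) is the tuple `(φ a'_j)_j`, freely. Written by res-type-027 g16. HONEST FRAMING: OURS; NOT a statement of
H. Hironaka's 2017 manuscript; AI-written, gate-checked, weaker than expert review. No `sorry`; standard axioms; DEF-FREE.
`--supports stmt-ResolutionOfSingularities-20148 --as helper`.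
* `linearCombination_eq_zero_of_hasKoszulSyzygies` — a relation `Σ cⱼ xⱼ = 0` has all `cⱼ ∈ (x)` (tree `HasKoszulSyzygies.mem_span_range`, Matsumura
  Thm. 16.5 (i)), hence `Σ cⱼ • bⱼ = 0` in any module killed by `(x)`;
* `linearMap_ext_of_generators` — two maps `(x) → Q` agreeing on the generators agree (uniqueness);
* `exists_linearMap_of_hasKoszulSyzygies` / `exists_linearMap_of_isWeaklyRegular` — for every tuple `b : Fin n → Q` (`Q` killed by the `xⱼ`) there
  is `φ : (x) →ₗ[R] Q` with `φ xⱼ = bⱼ` (existence; tree `hasKoszulSyzygies_of_isWeaklyRegular`). Together: `Hom_R((x), Q) ≅ Qⁿ`.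
References (method / index only): H. Matsumura, *Commutative Ring Theory* (1986), Thm. 16.5 (i); R. Hartshorne, *Deformation Theory* (2010), §2
(«`Hom(I/I², B) = Hom(I, B)`» for the normal module).
-/

noncomputable section

set_option linter.dupNamespace false

open RingTheory.Sequence Literature.RingTheory.Koszul

namespace Summit.ResolutionOfSingularities.ResolutionOfSingularities.Cruxes.EquisingularLiftNat.Sections

universe u v

variable {R : Type u} [CommRing R] {n : ℕ} (x : Fin n → R)
  {Q : Type v} [AddCommGroup Q] [Module R Q]

/-- A relation among generators with Koszul syzygies acts trivially on a module killed by the generators. [cite: Matsumura1987, Thm. 16.5 (i)] -/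
theorem linearCombination_eq_zero_of_hasKoszulSyzygies (h : HasKoszulSyzygies x) (hQ : ∀ (j : Fin n) (q : Q), x j • q = 0)
    (b : Fin n → Q) {c : Fin n → R} (hc : Fintype.linearCombination R x c = 0) : Fintype.linearCombination R b c = 0 := by
  rw [Fintype.linearCombination_apply] at hc ⊢
  have hc' : ∑ i, c i * x i = 0 := by simpa [smul_eq_mul] using hc
  refine Finset.sum_eq_zero fun j _ => ?_
  have hmem : c j ∈ Ideal.span (Set.range x) := h.mem_span_range hc' j
  have hkill : ∀ r ∈ Ideal.span (Set.range x), r • b j = 0 := by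
    intro r hr
    refine Submodule.span_induction (p := fun r _ => r • b j = 0) ?_ (zero_smul _ _) (fun a a' _ _ ha ha' => by rw [add_smul, ha, ha', add_zero])
      (fun a r _ hr => by rw [smul_eq_mul, mul_smul, hr, smul_zero]) hr
    rintro _ ⟨i, rfl⟩; exact hQ i _
  exact hkill _ hmem

/-- **Uniqueness**: two linear maps out of `(x₁,…,x_n)` agreeing on the generators are equal. [folklore] -/
theorem linearMap_ext_of_generators (φ ψ : ↥(Ideal.span (Set.range x)) →ₗ[R] Q)
    (h : ∀ j, φ ⟨x j, Ideal.subset_span ⟨j, rfl⟩⟩ = ψ ⟨x j, Ideal.subset_span ⟨j, rfl⟩⟩) : φ = ψ := by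
  apply LinearMap.ext
  rintro ⟨s, hs⟩
  refine Submodule.span_induction (p := fun s hs => φ ⟨s, hs⟩ = ψ ⟨s, hs⟩) ?_ ?_ ?_ ?_ hs
  · rintro _ ⟨j, rfl⟩; exact h j
  · have h1 : (⟨0, Submodule.zero_mem _⟩ : ↥(Ideal.span (Set.range x))) = 0 := rfl
    rw [h1, map_zero, map_zero]
  · intro a a' ha ha' iha iha'
    have h1 : (⟨a + a', Submodule.add_mem _ ha ha'⟩ : ↥(Ideal.span (Set.range x))) = ⟨a, ha⟩ + ⟨a', ha'⟩ := rfl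
    rw [h1, map_add, map_add, iha, iha']
  · intro r a ha iha
    have h1 : (⟨r • a, Submodule.smul_mem _ r ha⟩ : ↥(Ideal.span (Set.range x))) = r • ⟨a, ha⟩ := rfl
    rw [h1, map_smul, map_smul, iha]

/-- **Existence**: for generators `x` with Koszul syzygies and a module `Q` killed by them, every tuple `b ∈ Qⁿ` is the tuple of values of a linear
map `(x) → Q` (`Σ cⱼxⱼ ↦ Σ cⱼbⱼ` is well defined). [cite: Matsumura1987, Thm. 16.5 (i)] -/
theorem exists_linearMap_of_hasKoszulSyzygies (h : HasKoszulSyzygies x) (hQ : ∀ (j : Fin n) (q : Q), x j • q = 0) (b : Fin n → Q) :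
    ∃ φ : ↥(Ideal.span (Set.range x)) →ₗ[R] Q, ∀ j, φ ⟨x j, Ideal.subset_span ⟨j, rfl⟩⟩ = b j := by
  classical
  let ψ : (Fin n → R) →ₗ[R] R := Fintype.linearCombination R x
  have hψ : LinearMap.range ψ = Ideal.span (Set.range x) := by
    rw [Fintype.range_linearCombination]
  let χ : ((Fin n → R) ⧸ LinearMap.ker ψ) →ₗ[R] Q :=
    (LinearMap.ker ψ).liftQ (Fintype.linearCombination R b)
      (fun c hc => LinearMap.mem_ker.mpr (linearCombination_eq_zero_of_hasKoszulSyzygies x h hQ b (LinearMap.mem_ker.mp hc)))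
  let e : ↥(Ideal.span (Set.range x)) ≃ₗ[R] ((Fin n → R) ⧸ LinearMap.ker ψ) :=
    (LinearEquiv.ofEq _ _ hψ.symm) ≪≫ₗ ψ.quotKerEquivRange.symm
  refine ⟨χ ∘ₗ e.toLinearMap, fun j => ?_⟩
  have hxj : ψ (Pi.single j 1) = x j := by
    simp [ψ, Fintype.linearCombination_apply, Pi.single_apply]
  have he : e ⟨x j, Ideal.subset_span ⟨j, rfl⟩⟩ = Submodule.Quotient.mk (Pi.single j 1) := by
    apply ψ.quotKerEquivRange.injective
    simp only [e, LinearEquiv.trans_apply, LinearEquiv.apply_symm_apply]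
    apply Subtype.ext
    rw [LinearEquiv.coe_ofEq_apply, LinearMap.quotKerEquivRange_apply_mk, hxj]
  rw [LinearMap.comp_apply, LinearEquiv.coe_coe, he]
  change (LinearMap.ker ψ).liftQ (Fintype.linearCombination R b) _ (Submodule.Quotient.mk (Pi.single j 1)) = b j
  rw [Submodule.liftQ_apply]
  simp [Fintype.linearCombination_apply, Pi.single_apply]

/-- The weakly-regular case (tree `hasKoszulSyzygies_of_isWeaklyRegular`). [cite: Matsumura1987, Thm. 16.5 (i)] -/
theorem exists_linearMap_of_isWeaklyRegular (hx : IsWeaklyRegular R (List.ofFn x)) (hQ : ∀ (j : Fin n) (q : Q), x j • q = 0)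
    (b : Fin n → Q) : ∃ φ : ↥(Ideal.span (Set.range x)) →ₗ[R] Q, ∀ j, φ ⟨x j, Ideal.subset_span ⟨j, rfl⟩⟩ = b j :=
  exists_linearMap_of_hasKoszulSyzygies x (hasKoszulSyzygies_of_isWeaklyRegular x hx) hQ b

end Summit.ResolutionOfSingularities.ResolutionOfSingularities.Cruxes.EquisingularLiftNat.Sections

end
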